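import Summits.AnomalousDissipation.AnomalousDissipation.Theses.TaylorCertificates
import Summits.AnomalousDissipation.AnomalousDissipation.Theorems.TaylorCertificatesKolmogorovFloorResponseDefs
import Summits.AnomalousDissipation.AnomalousDissipation.Theorems.KolmogorovFloor.Negative.CheapBaseKill
import Summits.AnomalousDissipation.AnomalousDissipation.Theorems.KolmogorovFloor.Negative.BelowTaylorSupport
import Summits.AnomalousDissipation.AnomalousDissipation.Theorems.KolmogorovFloor.Negative.Rest

/-!
# KILL stub of line `Sketch` (digit-frame-closure), crux stmt-AnomalousDissipation-15122

`CheapStatesStatement → ¬ KolmogorovFloor`: CHEAP approximate steady Euler states for every admissible force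
refute the Kolmogorov-class floor BY NAME. `CheapStatesStatement` (the line's defs module
`TaylorCertificatesKolmogorovFloorResponseDefs`, §6) is VERBATIM the tree's
`Theorems.KolmogorovFloor.Negative.CheapSteadyEulerStates` of `Theorems/KolmogorovFloor/Negative/CheapStatesKill.lean`,
which proves `kolmogorovFloor_false_of_CheapSteadyEulerStates`. That module is not served by the Lean farm at the
time of writing (every importer is answered `unbuilt`), so this file re-runs its endgame (the proof text of the
tree's `Negative.floor_false_of_cheapStates`, inlined into the one theorem below) over the modules that ARE served:
the kernel `cheap_base_kill` (`Negative/CheapBaseKill.lean`), `rpow_le_of_le_root` (`Negative/BelowTaylorSupport.lean`),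
`rest_injects` (`Negative/Rest.lean`) and `ae_zero_of_integral_sq_zero` (`TaylorCertificatePair/Negative/Bounds.lean`).

Mechanism (card `Ideas/cheap-steady-euler-closure.md`, endgame `A′`): given the floor family `(N, Φ₁, θ₁)` of
`f` and, for every small `η`, a smooth solenoidal mean-zero state `a` with enstrophy and energy `≤ η^{-11/10}`,
slope `≤ η^{-3/5}`, work `≤ η^{2/5}` and steady-Euler defect `≤ η·M`, choose `ν := η^{3/2}`: then
`den ≤ (4π²+1)η^{9/10}`, the Kolmogorov price is `≤ 800π²(1+2Θ)C′²η^{-3/4}`, `den·price = O(η^{3/20}) → 0`,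
and `cheap_base_kill` fires. (The degenerate force `‖f‖₂ = 0` is excluded by the floor at rest, `rest_injects`.)
-/

noncomputable section

set_option linter.dupNamespace false

open MeasureTheory UnitAddTorus Matrix
open scoped InnerProductSpace ENNReal ComplexConjugate

namespace Summit.AnomalousDissipation.AnomalousDissipation.Theorems.KolmogorovFloor.Response

open Literature.Analysis.FunctionSpaces Literature.Analysis.FluidPDE
open Summit.AnomalousDissipation.AnomalousDissipation.Theorems.TaylorCertificatePair.Negative
open Summit.AnomalousDissipation.AnomalousDissipation.Theorems.KolmogorovFloor.Negative
open Summit.AnomalousDissipation.AnomalousDissipation.Theses.TaylorCertificates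

set_option maxHeartbeats 400000 in
/-- **KILL.** CHEAP approximate steady Euler states for every admissible force refute the crux BY NAME
(mirror of the tree's `Negative.kolmogorovFloor_false_of_CheapSteadyEulerStates`, whose module is farm-unbuilt;
`CheapStatesStatement` is that file's `CheapSteadyEulerStates` verbatim; the proof is the tree's
`Negative.floor_false_of_cheapStates` run over `cheap_base_kill`). -/
theorem kolmogorovFloor_false_of_cheapStatesStatement : CheapStatesStatement → ¬ KolmogorovFloor := by
  rintro hCHEAP ⟨f, hf, hfd, hfz, ε₀, C, Θ, ν₀, hε₀, hν₀, hfloor⟩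
  obtain ⟨η₀, hη₀, hcheap⟩ := hCHEAP f hf hfd hfz
  have hF2nn : 0 ≤ ∫ x, ‖f x‖ ^ 2 := integral_nonneg fun x => by positivity
  by_cases hF0 : ∫ x, ‖f x‖ ^ 2 = 0
  · obtain ⟨N, Φ₁, θ₁, -, -, -, -, hu⟩ := hfloor (ν₀ / 2) (by positivity) (by linarith)
    have hinj := rest_injects (by positivity : (0 : ℝ) < ν₀ / 2) hu
    have hae := ae_zero_of_integral_sq_zero hf hF0
    have hzero : (∫ x, ⟪f x, Φ₁.grad 0 x⟫_ℝ) = 0 := by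
      rw [← integral_zero (α := (UnitAddTorus (Fin 3))) (G := ℝ)]
      refine integral_congr_ae ?_
      filter_upwards [hae] with x hx
      simp [hx]
    linarith
  have hF2 : 0 < ∫ x, ‖f x‖ ^ 2 := lt_of_le_of_ne hF2nn (Ne.symm hF0)
  obtain ⟨F2, hF2def⟩ : ∃ F2 : ℝ, F2 = ∫ x, ‖f x‖ ^ 2 := ⟨_, rfl⟩
  rw [← hF2def] at hF2
  /- thresholds (with `Θ⁺ = max Θ 0`, `C' = max C 1`) -/
  obtain ⟨Θ', hΘ'⟩ : ∃ Θ' : ℝ, Θ' = max Θ 0 := ⟨_, rfl⟩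
  have hΘ'0 : 0 ≤ Θ' := by rw [hΘ']; exact le_max_right _ _
  obtain ⟨C', hC'⟩ : ∃ C' : ℝ, C' = max C 1 := ⟨_, rfl⟩
  have hC'1 : 1 ≤ C' := by rw [hC']; exact le_max_right _ _
  obtain ⟨K₂, hK₂def⟩ : ∃ K₂ : ℝ, K₂ = (4 * Real.pi ^ 2 + 1) * (800 * Real.pi ^ 2 * (1 + 2 * Θ') * C' ^ 2) := ⟨_, rfl⟩
  have hK₂ : 0 < K₂ := by rw [hK₂def]; positivity
  obtain ⟨ρ₁, hρ₁⟩ : ∃ ρ₁ : ℝ, ρ₁ = ε₀ / (4 * (4 * (1 + 2 * Θ') + 2 * Θ' + 1)) := ⟨_, rfl⟩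
  have hρ₁0 : 0 < ρ₁ := by rw [hρ₁]; positivity
  obtain ⟨ρ₂, hρ₂⟩ : ∃ ρ₂ : ℝ, ρ₂ = ε₀ / (3 * K₂) := ⟨_, rfl⟩
  have hρ₂0 : 0 < ρ₂ := by rw [hρ₂]; positivity
  obtain ⟨ρ₃, hρ₃⟩ : ∃ ρ₃ : ℝ, ρ₃ = 1 / (5 * (4 * Real.pi ^ 2 + 1)) := ⟨_, rfl⟩
  have hρ₃0 : 0 < ρ₃ := by rw [hρ₃]; positivity
  obtain ⟨ρ₄, hρ₄⟩ : ∃ ρ₄ : ℝ, ρ₄ = 16 * F2 / 10 := ⟨_, rfl⟩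
  have hρ₄0 : 0 < ρ₄ := by rw [hρ₄]; positivity
  obtain ⟨m, hmdef⟩ : ∃ m : ℝ, m = min (min (min (min ν₀ η₀) 1) (min (ρ₁ ^ (1 / (2 / 5 : ℝ))) (ρ₂ ^ (1 / (3 / 20 : ℝ)))))
      (min (ρ₃ ^ (1 / (9 / 10 : ℝ))) (ρ₄ ^ (1 / (19 / 10 : ℝ)))) := ⟨_, rfl⟩
  have hm0 : 0 < m := by
    rw [hmdef]
    exact lt_min (lt_min (lt_min (lt_min hν₀ hη₀) one_pos) (lt_min (Real.rpow_pos_of_pos hρ₁0 _) (Real.rpow_pos_of_pos hρ₂0 _)))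
      (lt_min (Real.rpow_pos_of_pos hρ₃0 _) (Real.rpow_pos_of_pos hρ₄0 _))
  obtain ⟨η, hηdef⟩ : ∃ η : ℝ, η = m / 2 := ⟨_, rfl⟩
  have hη : 0 < η := by rw [hηdef]; positivity
  have hηm : η < m := by rw [hηdef]; linarith
  have hm1 : m ≤ min (min (min ν₀ η₀) 1) (min (ρ₁ ^ (1 / (2 / 5 : ℝ))) (ρ₂ ^ (1 / (3 / 20 : ℝ)))) := by rw [hmdef]; exact min_le_left _ _
  have hm2 : m ≤ min (ρ₃ ^ (1 / (9 / 10 : ℝ))) (ρ₄ ^ (1 / (19 / 10 : ℝ))) := by rw [hmdef]; exact min_le_right _ _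
  have hην₀ : η < ν₀ := hηm.trans_le (((hm1.trans (min_le_left _ _)).trans (min_le_left _ _)).trans (min_le_left _ _))
  have hηη₀ : η < η₀ := hηm.trans_le (((hm1.trans (min_le_left _ _)).trans (min_le_left _ _)).trans (min_le_right _ _))
  have hη1 : η < 1 := hηm.trans_le ((hm1.trans (min_le_left _ _)).trans (min_le_right _ _))
  have hηρ₁ : η ^ (2 / 5 : ℝ) ≤ ρ₁ :=
    rpow_le_of_le_root hη hρ₁0 (by norm_num) (hηm.le.trans (((hm1.trans (min_le_right _ _)).trans (min_le_left _ _))))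
  have hηρ₂ : η ^ (3 / 20 : ℝ) ≤ ρ₂ :=
    rpow_le_of_le_root hη hρ₂0 (by norm_num) (hηm.le.trans (((hm1.trans (min_le_right _ _)).trans (min_le_right _ _))))
  have hηρ₃ : η ^ (9 / 10 : ℝ) ≤ ρ₃ :=
    rpow_le_of_le_root hη hρ₃0 (by norm_num) (hηm.le.trans ((hm2.trans (min_le_left _ _))))
  have hηρ₄ : η ^ (19 / 10 : ℝ) ≤ ρ₄ :=
    rpow_le_of_le_root hη hρ₄0 (by norm_num) (hηm.le.trans ((hm2.trans (min_le_right _ _))))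
  /- the viscosity `ν = η^{3/2}` -/
  obtain ⟨ν, hνdef⟩ : ∃ ν : ℝ, ν = η ^ (3 / 2 : ℝ) := ⟨_, rfl⟩
  have hν : 0 < ν := by rw [hνdef]; exact Real.rpow_pos_of_pos hη _
  have hνη : ν ≤ η := by rw [hνdef]; exact Real.rpow_le_self_of_le_one hη.le hη1.le (by norm_num)
  have hνν₀ : ν < ν₀ := hνη.trans_lt hην₀
  have hν1 : ν ≤ 1 := hνη.trans hη1.le
  /- the certificate and the cheap state -/
  obtain ⟨N, Φ₁, θ₁, hN, hband, hθ₁, hθ₁', hu⟩ := hfloor ν hν hνν₀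
  have hΘ : 0 ≤ Θ := by linarith only [hθ₁, hθ₁']
  have hΘeq : Θ' = Θ := by rw [hΘ']; exact max_eq_left hΘ
  rw [hΘeq] at hK₂def hρ₁
  obtain ⟨a, ha, had, haz, hEa, hAa, hSa, hPa, hdef⟩ := hcheap η hη hηη₀
  /- rpow identities -/
  have e1 : ν * η ^ (-(11 / 10 : ℝ)) = η ^ (2 / 5 : ℝ) := by
    rw [hνdef, ← Real.rpow_add hη]; norm_num
  have e2 : ν * η ^ (-(3 / 5 : ℝ)) = η ^ (9 / 10 : ℝ) := by
    rw [hνdef, ← Real.rpow_add hη]; norm_num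
  have e3 : ν ^ (-(3 / 4 : ℝ)) = η ^ (-(9 / 8 : ℝ)) := by
    rw [hνdef, ← Real.rpow_mul hη.le]; norm_num
  have e4 : ν * (η ^ (-(9 / 8 : ℝ)) * η ^ (-(9 / 8 : ℝ))) = η ^ (-(3 / 4 : ℝ)) := by
    rw [hνdef, ← Real.rpow_add hη, ← Real.rpow_add hη]; norm_num
  have e5 : η ^ (9 / 10 : ℝ) * η ^ (-(3 / 4 : ℝ)) = η ^ (3 / 20 : ℝ) := by
    rw [← Real.rpow_add hη]; norm_num
  have e6 : ν ^ 2 = η ^ (3 : ℝ) := by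
    rw [hνdef, ← Real.rpow_natCast, ← Real.rpow_mul hη.le]; norm_num
  have e7 : η ^ (3 : ℝ) * η ^ (-(11 / 10 : ℝ)) = η ^ (19 / 10 : ℝ) := by
    rw [← Real.rpow_add hη]; norm_num
  have hη09 : η ≤ η ^ (9 / 10 : ℝ) := Real.self_le_rpow_of_le_one hη.le hη1.le (by norm_num)
  have hηneg : 1 ≤ η ^ (-(11 / 10 : ℝ)) := Real.one_le_rpow_of_pos_of_le_one_of_nonpos hη hη1.le (by norm_num)
  /- (h1) quietness and work -/
  have h1 : (1 + 2 * Θ) * (ν * (4 * η ^ (-(11 / 10 : ℝ)))) + 2 * Θ * η ^ (2 / 5 : ℝ) ≤ ε₀ / 4 := by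
    have e : (1 + 2 * Θ) * (ν * (4 * η ^ (-(11 / 10 : ℝ)))) + 2 * Θ * η ^ (2 / 5 : ℝ) =
        (4 * (1 + 2 * Θ) + 2 * Θ) * η ^ (2 / 5 : ℝ) := by rw [← e1]; ring
    rw [e]
    have hle : η ^ (2 / 5 : ℝ) ≤ ε₀ / (4 * (4 * (1 + 2 * Θ) + 2 * Θ + 1)) := by rw [← hρ₁]; exact hηρ₁
    rw [le_div_iff₀ (by positivity)] at hle
    have h0 : 0 ≤ η ^ (2 / 5 : ℝ) := Real.rpow_nonneg hη.le _
    nlinarith only [hle, h0, hΘ]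
  /- (h2) `den · Π ≤ ε₀/3` -/
  have hN0 : (0 : ℝ) ≤ N := Nat.cast_nonneg N
  have hN' : (N : ℝ) ≤ C' * η ^ (-(9 / 8 : ℝ)) := by
    rw [← e3]
    exact hN.trans (mul_le_mul_of_nonneg_right (by rw [hC']; exact le_max_left _ _) (Real.rpow_nonneg hν.le _))
  have hη98 : 1 ≤ η ^ (-(9 / 8 : ℝ)) := Real.one_le_rpow_of_pos_of_le_one_of_nonpos hη hη1.le (by norm_num)
  have h4N : (((4 * N + 1 : ℕ)) : ℝ) ≤ 5 * (C' * η ^ (-(9 / 8 : ℝ))) := by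
    push_cast
    have : (1 : ℝ) ≤ C' * η ^ (-(9 / 8 : ℝ)) := one_le_mul_of_one_le_of_one_le hC'1 hη98
    linarith only [hN', this]
  have h4N2 : ν * (((4 * N + 1 : ℕ)) : ℝ) ^ 2 ≤ 25 * C' ^ 2 * η ^ (-(3 / 4 : ℝ)) := by
    have h0 : (0 : ℝ) ≤ (((4 * N + 1 : ℕ)) : ℝ) := Nat.cast_nonneg _
    calc ν * (((4 * N + 1 : ℕ)) : ℝ) ^ 2 ≤ ν * (5 * (C' * η ^ (-(9 / 8 : ℝ)))) ^ 2 :=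
          mul_le_mul_of_nonneg_left (pow_le_pow_left₀ h0 h4N 2) hν.le
      _ = 25 * C' ^ 2 * (ν * (η ^ (-(9 / 8 : ℝ)) * η ^ (-(9 / 8 : ℝ)))) := by ring
      _ = 25 * C' ^ 2 * η ^ (-(3 / 4 : ℝ)) := by rw [e4]
  have hden : 4 * Real.pi ^ 2 * ν * η ^ (-(3 / 5 : ℝ)) + η ≤ (4 * Real.pi ^ 2 + 1) * η ^ (9 / 10 : ℝ) := by
    have e : 4 * Real.pi ^ 2 * ν * η ^ (-(3 / 5 : ℝ)) = 4 * Real.pi ^ 2 * η ^ (9 / 10 : ℝ) := by rw [← e2]; ring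
    rw [e]; nlinarith only [hη09, Real.pi_pos]
  have hden0 : 0 ≤ 4 * Real.pi ^ 2 * ν * η ^ (-(3 / 5 : ℝ)) + η := by positivity
  have h2 : (4 * Real.pi ^ 2 * ν * η ^ (-(3 / 5 : ℝ)) + η) *
      (32 * Real.pi ^ 2 * (1 + 2 * Θ) * ν * (((4 * N + 1 : ℕ)) : ℝ) ^ 2) ≤ ε₀ / 3 := by
    have hPi : 32 * Real.pi ^ 2 * (1 + 2 * Θ) * ν * (((4 * N + 1 : ℕ)) : ℝ) ^ 2 ≤
        800 * Real.pi ^ 2 * (1 + 2 * Θ) * C' ^ 2 * η ^ (-(3 / 4 : ℝ)) := by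
      have := mul_le_mul_of_nonneg_left h4N2 (by positivity : (0 : ℝ) ≤ 32 * Real.pi ^ 2 * (1 + 2 * Θ))
      linarith only [this]
    have hPi0 : 0 ≤ 32 * Real.pi ^ 2 * (1 + 2 * Θ) * ν * (((4 * N + 1 : ℕ)) : ℝ) ^ 2 := by positivity
    calc _ ≤ ((4 * Real.pi ^ 2 + 1) * η ^ (9 / 10 : ℝ)) * (800 * Real.pi ^ 2 * (1 + 2 * Θ) * C' ^ 2 * η ^ (-(3 / 4 : ℝ))) :=
          mul_le_mul hden hPi hPi0 (by positivity)
      _ = K₂ * (η ^ (9 / 10 : ℝ) * η ^ (-(3 / 4 : ℝ))) := by rw [hK₂def]; ring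
      _ = K₂ * η ^ (3 / 20 : ℝ) := by rw [e5]
      _ ≤ K₂ * ρ₂ := mul_le_mul_of_nonneg_left hηρ₂ hK₂.le
      _ = ε₀ / 3 := by rw [hρ₂]; field_simp
  /- (h3) `5 den ≤ 1` -/
  have h3 : 5 * (4 * Real.pi ^ 2 * ν * η ^ (-(3 / 5 : ℝ)) + η) ≤ 1 := by
    have hle : η ^ (9 / 10 : ℝ) ≤ 1 / (5 * (4 * Real.pi ^ 2 + 1)) := by rw [← hρ₃]; exact hηρ₃
    rw [le_div_iff₀ (by positivity)] at hle
    nlinarith only [hden, hle, Real.pi_pos]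
  /- the Leray ball -/
  have hball : 2 * (∫ x, ‖a x‖ ^ 2) + 8 ≤ 16 * (∫ x, ‖f x‖ ^ 2) / ν ^ 2 := by
    rw [← hF2def, e6, le_div_iff₀ (Real.rpow_pos_of_pos hη _)]
    have hle : η ^ (19 / 10 : ℝ) ≤ 16 * F2 / 10 := by rw [← hρ₄]; exact hηρ₄
    have h3pos : 0 ≤ η ^ (3 : ℝ) := Real.rpow_nonneg hη.le _
    have hA : (2 * (∫ x, ‖a x‖ ^ 2) + 8) * η ^ (3 : ℝ) ≤ 10 * (η ^ (3 : ℝ) * η ^ (-(11 / 10 : ℝ))) := by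
      have : 2 * (∫ x, ‖a x‖ ^ 2) + 8 ≤ 10 * η ^ (-(11 / 10 : ℝ)) := by linarith only [hAa, hηneg]
      have := mul_le_mul_of_nonneg_right this h3pos
      linarith only [this]
    rw [e7] at hA
    linarith only [hA, hle]
  /- the kill -/
  refine cheap_base_kill hf hν Φ₁ hband hθ₁ hθ₁' hε₀ ha had haz (Ea := η ^ (-(11 / 10 : ℝ))) (Sa := η ^ (-(3 / 5 : ℝ)))
    (Pa := η ^ (2 / 5 : ℝ)) (η := η) hEa (hSa N) (Real.rpow_nonneg hη.le _) hPa hη.le (hdef N) h1 h2 h3 hball ?_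
  intro u hfin hballu
  have h := hu u
  dsimp only at h
  exact h hfin hballu

end Summit.AnomalousDissipation.AnomalousDissipation.Theorems.KolmogorovFloor.Response
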